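import Literature.AlgebraicGeometry.Motives.AbelTheoremConjugateSpecialisation
import Literature.AlgebraicGeometry.Motives.JacobianAbelJacobiSum
import Literature.AlgebraicGeometry.Motives.CurveDivisorsFunctionField
import Literature.NumberTheory.DiophantineGeometry.FunctionFieldGenusRiemannRochProofs
import Literature.NumberTheory.DiophantineGeometry.FunctionFieldGenusProofs
import Mathlib.FieldTheory.Normal.Closure
import Mathlib.RingTheory.AlgebraicIndependent.Adjoin
import HarnessLib

/-!
# Abel's theorem (Lang, *Abelian Varieties*, II §2 Thm. 10; Lange, Thm. 4.1.4; Milne, *Jacobian Varieties*, §2–§3)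

**Abel's theorem.** For a smooth proper curve `C` over an algebraically closed field `Ω` of
characteristic `0`, an abelian variety `A/Ω`, a morphism `f : C ⟶ A.X` and `0 ≠ h ∈ K(C)`:

  `∏_{P ∈ C(Ω)} f(P) ^ {ord_P h} = 1`  in `A(Ω)`

(S. Lang, *Abelian Varieties*, II §2 Thm. 10: the map `𝔞 ↦ S(f(𝔞))` on divisors of degree `0`
vanishes on principal divisors; for `A = J(C)`, `f = α_c` the Abel–Jacobi map this is Abel's
theorem, H. Lange, *Abelian Varieties over the Complex Numbers*, Thm. 4.1.4 «its kernel is the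
subgroup of principal divisors», J. S. Milne, *Jacobian Varieties*, §2–§3). This file finishes
the assembly of LANG'S SPECIALISATION PROOF begun in
`Motives/AbelTheoremConjugateSpecialisation` (symmetric function of the conjugates of a point over
the generic point of the `h`-line is constant — Galois descent + `A(Ω(h)) = A(Ω)` — and
specialises with multiplicities `e(v ∣ P₀)`), by instantiating the tower there with
`F₀ := Ω(h) ⊆ K(C)` (`h` transcendental; `Frac Ω[X] ≃ Ω(h)` by
`AlgebraicIndependent.aevalEquivField`) and `M :=` the normal closure of `K(C)/Ω(h)` in an
algebraic closure (finite Galois in characteristic `0`):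

* `AbelianVariety.finprod_map_ptOfPlace_zpow_ord_eq_one` — the statement over the places `v` of
  `K(C)/Ω` (`x_v ∈ C(Ω)` the point of `v`); constants `h` have no zeros or poles;
* `PlaceReduction.pt_ptOfPlace`, `AlgPoints.pt_ne_genericPoint_of_smoothCurve`,
  `PlaceReduction.ptOfPlace_bijective` — places of `K(C)` ↔ `Ω`-points of `C`
  (`CurvePlaces.pointEquivPlace`, `AlgPoints.eq_of_pt_eq`);
* **`AbelianVariety.finprod_map_zpow_ord_pt_eq_one`** — the statement over `C(Ω)`;
* **`Jacobian.ajSum_principal`** — `aj_c(div h) = 1` for the Abel–Jacobi sum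
  `Jacobian.ajSum` of `Motives/JacobianAbelJacobiSum` and EVERY Jacobian `𝒥 : Jacobian C` (the
  universal-property Jacobian of `Motives/Jacobian`; no model of `J` is used), and
  **`Jacobian.ajSum_congr_linEquiv`** — `aj_c` is a class invariant.

Everything is proved; no definitions, no named facts (D-0026).

## References

* S. Lang, *Abelian Varieties*, Interscience 1959 / Springer 1983, II §2 Thm. 10.
  [Lang1983AbelianVarieties]
* H. Lange, *Abelian Varieties over the Complex Numbers*, Grundlehren Text Editions, Springer 2023,
  §4.1.3 Thm. 4.1.4 (p. 206). [Lange2023AbelianVarietiesComplex]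
* J. S. Milne, *Jacobian Varieties*, in: Arithmetic Geometry (Cornell–Silverman, eds.), Springer
  1986, §2 and §3. [Milne1986JacobianVarieties]
* R. Hartshorne, *Algebraic Geometry* (1977), I.6 Cor. 6.6 and Thm. 6.9. [Hartshorne1977]
-/

noncomputable section

open CategoryTheory AlgebraicGeometry

universe u

namespace Literature.AlgebraicGeometry.Motives

open scoped MonObj IntermediateField

open Literature.NumberTheory.DiophantineGeometry
  Literature.NumberTheory.DiophantineGeometry.AlgFunctionField

/-! ### Places of `K(C)` and `Ω`-points of `C` -/

namespace PlaceReduction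

variable {Ω : Type u} [Field Ω] [IsAlgClosed Ω] {C : SchemeOver Ω} [IsIntegral C.left]
  [SmoothOfRelativeDimension 1 C.hom] [IsProper C.hom]

open CurvePlaces

/-- The underlying point of `x_v = ptOfPlace v` is the centre of the place `v`.
[cite: Hartshorne1977, I.6 Cor. 6.6 and Thm. 6.9] -/
theorem pt_ptOfPlace (v : PlaceOver Ω C.left.functionField) :
    (ptOfPlace (C := C) v).pt = pointOfPlace (C := C) v :=
  ptOfPlace_left_closedPoint v

omit [IsAlgClosed Ω] in
/-- The underlying point of an `Ω`-point of the proper smooth curve `C` is not the generic point (it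
is closed, while the generic point specialises to the centre of any place). [cite: Hartshorne1977, I.6 Cor. 6.6 and Thm. 6.9] -/
theorem _root_.Literature.AlgebraicGeometry.Motives.AlgPoints.pt_ne_genericPoint_of_smoothCurve
    (P : AlgPoints C Ω) : P.pt ≠ genericPoint C.left := by
  intro h
  have hcl := AlgPoints.isClosed_singleton_pt P
  obtain ⟨v⟩ : Nonempty (PlaceOver Ω C.left.functionField) := nonempty_placeOver
  apply pointOfPlace_ne_genericPoint (C := C) v
  have hmem : pointOfPlace (C := C) v ∈ closure ({genericPoint C.left} : Set C.left) := by
    rw [(genericPoint_spec C.left).def]; trivial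
  rw [← h, hcl.closure_eq] at hmem
  rw [hmem, h]

/-- **Places of `K(C)/Ω` ↔ `Ω`-points of `C`**: `v ↦ x_v` is a bijection (Hartshorne I.6
Cor. 6.6 / Thm. 6.9: closed points of the complete non-singular curve ↔ discrete valuation rings of `K(C)/Ω`;
over `Ω = Ω̄` closed points are `Ω`-points). [cite: Hartshorne1977, I.6 Cor. 6.6 and Thm. 6.9] -/
theorem ptOfPlace_bijective : Function.Bijective (ptOfPlace (C := C)) := by
  haveI : LocallyOfFiniteType C.hom :=
    haveI : Smooth C.hom := SmoothOfRelativeDimension.smooth 1 C.hom; inferInstance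
  constructor
  · intro v w h
    have h' := congrArg AlgPoints.pt h
    rw [pt_ptOfPlace, pt_ptOfPlace] at h'
    rw [← place_pointOfPlace (C := C) v, ← place_pointOfPlace (C := C) w]
    simp_rw [h']
  · intro P
    refine ⟨place C P.pt (AlgPoints.pt_ne_genericPoint_of_smoothCurve P), AlgPoints.eq_of_pt_eq ?_⟩
    rw [pt_ptOfPlace, pointOfPlace_place]

end PlaceReduction

/-! ### Abel's theorem for a morphism `f : C → A` (Lang, II §2 Thm. 10) -/

namespace AbelianVariety

open PlaceReduction

variable {Ω : Type u} [Field Ω] [IsAlgClosed Ω] [CharZero Ω]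
  {C : SchemeOver Ω} [IsIntegral C.left] [SmoothOfRelativeDimension 1 C.hom] [IsProper C.hom]
  (A : AbelianVariety Ω) (f : C ⟶ A.X)

/-- **Abel's theorem (Lang, *Abelian Varieties*, II §2 Thm. 10), over the places**: for a smooth
proper curve `C/Ω` (`Ω` algebraically closed of characteristic `0`), a morphism `f : C ⟶ A.X` to
an abelian variety and `0 ≠ h ∈ K(C)`, `∏ᶠ_v f(x_v) ^ {ord_v h} = 1`, the product over the places
`v` of `K(C)/Ω` (`x_v ∈ C(Ω)` the point of `v`). Proof: an algebraic `h` has no zeros or poles;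
for `h` transcendental apply `finprod_map_ptOfPlace_zpow_ord_algebraMap_eq_one`
(`Motives/AbelTheoremConjugateSpecialisation`) to the tower `Ω ⊆ Ω(h) ⊆ K(C) ⊆ M`, `M` the normal
closure of `K(C)/Ω(h)` in an algebraic closure (finite Galois), `Frac Ω[X] ≃ Ω(h)`.
[cite: Lang1983AbelianVarieties, II §2 Thm. 10] -/
theorem finprod_map_ptOfPlace_zpow_ord_eq_one {h : C.left.functionField} (hh : h ≠ 0) :
    ∏ᶠ v : PlaceOver Ω C.left.functionField, AlgPoints.map f (ptOfPlace v) ^ v.ord h = 1 := by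
  by_cases halg : IsAlgebraic Ω h
  · exact finprod_eq_one_of_forall_eq_one fun v => by
      rw [PlaceOver.ord_eq_zero_of_isAlgebraic v hh halg, zpow_zero]
  -- `h` transcendental: the tower `Ω ⊆ F₀ = Ω⟮h⟯ ⊆ L = K(C) ⊆ M`
  have hT : Transcendental Ω h := halg
  haveI : FiniteDimensional Ω⟮h⟯ C.left.functionField :=
    IsAlgFunctionField.finiteDimensional_adjoin_simple hT
  haveI : IsAlgFunctionField Ω Ω⟮h⟯ := IsAlgFunctionField.of_intermediateField Ω⟮h⟯
  haveI : Algebra.IsAlgebraic Ω⟮h⟯ C.left.functionField := Algebra.IsAlgebraic.of_finite _ _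
  -- `Frac Ω[X] ≃ Ω⟮h⟯`
  have hx : AlgebraicIndependent Ω (fun _ : Fin 1 => h) := algebraicIndependent_unique_type_iff.2 hT
  have hr : Set.range (fun _ : Fin 1 => h) = {h} := Set.range_const
  let e : FractionRing (MvPolynomial (Fin 1) Ω) ≃ₐ[Ω] Ω⟮h⟯ :=
    hx.aevalEquivField.trans (IntermediateField.equivOfEq (by rw [hr]))
  -- the normal closure `M` of `K(C)/Ω⟮h⟯`: finite Galois, a function field over `Ω`
  let M : IntermediateField Ω⟮h⟯ (AlgebraicClosure C.left.functionField) :=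
    IntermediateField.normalClosure Ω⟮h⟯ C.left.functionField (AlgebraicClosure C.left.functionField)
  haveI : IsScalarTower Ω C.left.functionField M := IsScalarTower.of_algebraMap_eq fun c => by
    apply Subtype.ext
    change algebraMap Ω (AlgebraicClosure C.left.functionField) c =
      algebraMap C.left.functionField (AlgebraicClosure C.left.functionField)
        (algebraMap Ω C.left.functionField c)
    exact IsScalarTower.algebraMap_apply Ω C.left.functionField (AlgebraicClosure _) c
  haveI : FiniteDimensional C.left.functionField M :=
    Module.Finite.of_restrictScalars_finite Ω⟮h⟯ C.left.functionField M
  haveI : IsAlgFunctionField Ω M :=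
    isAlgFunctionField_of_finiteDimensional (K := Ω) (F := C.left.functionField)
  haveI : Algebra.IsAlgebraic Ω⟮h⟯ (AlgebraicClosure C.left.functionField) :=
    Algebra.IsAlgebraic.trans Ω⟮h⟯ C.left.functionField (AlgebraicClosure C.left.functionField)
  haveI : IsAlgClosure Ω⟮h⟯ (AlgebraicClosure C.left.functionField) :=
    { isAlgClosed := inferInstance, isAlgebraic := inferInstance }
  haveI : Normal Ω⟮h⟯ (AlgebraicClosure C.left.functionField) := IsAlgClosure.normal _ _
  haveI : Normal Ω⟮h⟯ M := normalClosure.normal Ω⟮h⟯ C.left.functionField (AlgebraicClosure _)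
  haveI : IsGalois Ω⟮h⟯ M := ⟨⟩
  -- Abel's theorem along this tower, for `y = h ∈ Ω⟮h⟯`
  have hy : (⟨h, IntermediateField.mem_adjoin_simple_self Ω h⟩ : Ω⟮h⟯) ≠ 0 := fun h0 =>
    hh (congrArg Subtype.val h0)
  exact finprod_map_ptOfPlace_zpow_ord_algebraMap_eq_one A f (F₀ := Ω⟮h⟯) (M := M) e hy

/-- **Abel's theorem (Lang, *Abelian Varieties*, II §2 Thm. 10), over the points**: for a smooth
proper curve `C/Ω` (`Ω` algebraically closed of characteristic `0`), a morphism `f : C ⟶ A.X` to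
an abelian variety and `0 ≠ h ∈ K(C)`: `∏ᶠ_{P ∈ C(Ω)} f(P) ^ {ord_P h} = 1` in `A(Ω)` («the map
`𝔞 ↦ S(f(𝔞))` on divisors of degree `0` … depends only on the linear equivalence class of `𝔞`»).
[cite: Lang1983AbelianVarieties, II §2 Thm. 10] -/
theorem finprod_map_zpow_ord_pt_eq_one {h : C.left.functionField} (hh : h ≠ 0) :
    ∏ᶠ P : AlgPoints C Ω, AlgPoints.map f P ^ Scheme.ord h P.pt = 1 := by
  rw [← finprod_map_ptOfPlace_zpow_ord_eq_one A f hh]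
  exact (finprod_eq_of_bijective (ptOfPlace (C := C)) ptOfPlace_bijective fun v => by
    rw [CurvePlaces.ord_eq_ord_pointOfPlace (C := C) v hh, ← pt_ptOfPlace]).symm

end AbelianVariety

/-! ### Abel's theorem for the Abel–Jacobi sum of a Jacobian (Lange Thm. 4.1.4) -/

namespace Jacobian

variable {k : Type u} [Field k] [IsAlgClosed k] [CharZero k] {C : SchemeOver k} [IsIntegral C.left]
  [IsLocallyNoetherian C.left] (𝒥 : Jacobian C)

/-- **ABEL'S THEOREM** for the Abel–Jacobi sum: `aj_c(div h) = 1` for every `0 ≠ h ∈ K(C)`, every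
base point `c ∈ C(k)` and EVERY Jacobian `𝒥` of the smooth proper curve `C` over an algebraically
closed field `k` of characteristic `0` (Lange, *Abelian Varieties over the Complex Numbers*,
Thm. 4.1.4: the kernel of the Abel–Jacobi map on `Div⁰(C)` «is the subgroup of principal divisors»
— the inclusion `principal ⊆ kernel`; Lang, *Abelian Varieties*, II §2 Thm. 10 with `f = α_c`).
[cite: Lange2023AbelianVarietiesComplex, §4.1.3 Thm. 4.1.4 (p. 206)] [cite: Lang1983AbelianVarieties, II §2 Thm. 10] -/
theorem ajSum_principal [SmoothOfRelativeDimension 1 C.hom] [IsProper C.hom] (c : AlgPoints C k)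
    {h : C.left.functionField} (hh : h ≠ 0) :
    𝒥.ajSum c (CartierDivisor.principal h hh) = 1 := by
  unfold ajSum
  simp only [CartierDivisor.ordAt_principal]
  exact AbelianVariety.finprod_map_zpow_ord_pt_eq_one 𝒥.J (𝒥.abelJacobi c) hh

/-- **`aj_c` is an invariant of the linear equivalence class**: `E ∼ F ⟹ aj_c(E) = aj_c(F)`
(`F ≈ E + div g`, additivity `ajSum_add` and Abel `ajSum_principal`). [cite: Lange2023AbelianVarietiesComplex, §4.1.3 Thm. 4.1.4 (p. 206)] -/
theorem ajSum_congr_linEquiv [SmoothOfRelativeDimension 1 C.hom] [IsProper C.hom] (c : AlgPoints C k)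
    {E F : CartierDivisor C.left} (h : E.LinEquiv F) : 𝒥.ajSum c E = 𝒥.ajSum c F := by
  obtain ⟨g, hg, hEF⟩ := h
  rw [← 𝒥.ajSum_congr_sameDivisor c hEF, 𝒥.ajSum_add, 𝒥.ajSum_principal c hg, mul_one]

end Jacobian

end Literature.AlgebraicGeometry.Motives

end
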